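/-
Copyright (c) 2026 the pub-hodgecm-mathlib formalisation cell (harness21).  Prover seat hodgecm-mathlib-K2E3-p14 (g9) (E3 hand on strike line L1; LEAD F0P6-plan (g14) BATCH #101 (4),
plan of record M-158q (4)), Track B «K2-LIT» ∕ hLiu418 = stmt-HodgeConjecture-24832: organ U1-CT-ind stage 3 («U1-glob»), BRICK B3 «(α)-LINEARITY» of the census
`K2/K2E3-p14/g9/CENSUS-U1glob-Stage3.K2E3-p14-g9.md` (desk K2Liu-p10 (g6) 22:49:24Z (b): «B3 is S over ★ U0.4 `resNorm_finset_sum`»).  THEOREMS ONLY.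
-/
import Summits.HodgeConjecture.HodgeConjecture.Theorems.K2LiuFirstTermResidueGenDefs   -- ★ U0 (K2Liu-p08 (g0)): `resGen`, `exists_continuation_resGen`, `resGen_eq_resNorm_of_continuation`; brings ★ U0.4 `resNorm_finset_sum`
import HarnessLib

/-!
# Crux `HLiu418`, organ U1-CT-ind STAGE 3 («U1-glob»), brick B3: THE CANONICAL RESIDUE OF A FINITE LINEAR COMBINATION OF SECTION FAMILIES
# «`resGen (Σ_j c_j • g_j) = Σ_j c_j · resGen (g_j)`, hence `0` when every `resGen (g_j) = 0`»   [KudlaRallis1994 §1 Thm. 1.1; Liu2021 Lem. B.12]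

Cell `hodgecm-mathlib`, crux item hLiu418 = `stmt-HodgeConjecture-24832`; squad K2, strike line L1, LEAD F0P6-plan (g14); desk K2Liu-p10 (g6) + K2Liu-p13 (g4); prover K2E3-p14 (g9).
Lane `--supports stmt-HodgeConjecture-24832 --as helper` (count-neutral).  THEOREMS ONLY (no `def`, no `instance`, no notation, no named-fact hypothesis, no `sorry`).  GENERIC in
the doubled datum `(e, dV, dW)`, the rank `n`, and the families.

THE POINT (census §2 B3).  U1-glob's hypothesis is a finite PURE decomposition `φ = Σ_i a_i(h^v)·b_i(h_v)` at the place `v` (★ `exists_sum_pure_at_of_isStandardSectionFamily` shape)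
with `N*_v(½) b_i = 0` for EVERY `i`; the END HEAD (B4) proves `resGen = 0` one pure term at a time (B1 + B2a + B2b) and sums.  The summation is ★ U0.4
`K2LiuFirstTermResidueForm.resNorm_finset_sum` («`resNorm` of `Σ c_j • g_j` = `Σ c_j · resNorm (g_j)` on ANY admissible continuations») read on the CANONICAL residue form
`resGen` of ★ `K2LiuFirstTermResidueGenDefs` (the chosen continuations ★ `exists_continuation_resGen`, choice-free by ★ `resGen_eq_resNorm_of_continuation`):
* **`resGen_finset_sum`** — `resGen hex = fun h => Σ_j c_j · resGen (hexg j) h` for `f = Σ_j c_j • g_j`, `g_j` continuous Siegel section families for a unitary `χ`;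
* **`resGen_eq_zero_of_finset_sum`** — hence `resGen hex = 0` as soon as `resGen (hexg j) = 0` for every `j`.
References: [KudlaRallis1994] S. Kudla, S. Rallis, Ann. of Math. 140 (1994), §1 Thm. 1.1; [Liu2021] Y. Liu, Invent. Math. (2021), App. B Lem. B.12 pp. 103–104;
[MoeglinWaldspurger1995] C. Mœglin, J.-L. Waldspurger, CUP (1995), IV.1.9–IV.1.11.
HONEST LABEL.  Count-neutral helper: `HC_CM` is proved only modulo the 7 printed citations (2 remaining named inputs: hLiu418 = `stmt-HodgeConjecture-24832`,
h413 = `stmt-HodgeConjecture-24833`) until rung 0 closes; U1-glob stays OPEN (B2a∕B2b∕B4∕B5).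
-/

set_option autoImplicit false
set_option linter.dupNamespace false -- the mandated namespace repeats `HodgeConjecture.HodgeConjecture`

noncomputable section

open scoped Topology BigOperators
open Filter NumberField IsDedekindDomain
open Literature.NumberTheory.Automorphic Literature.NumberTheory.GaloisRepresentations
open Literature.NumberTheory.GelbartRogawski1991 Literature.NumberTheory.GelbartRogawski1991.GRConstruction
open Literature.NumberTheory.K2Lit.SiegelDoubled

namespace Summit.HodgeConjecture.HodgeConjecture.Cruxes.HLiu418.K2LiuResidueGenFinsetSum

open Summit.HodgeConjecture.HodgeConjecture.Cruxes.HLiu418.K2LiuFirstTermResidueFormDefs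
open Summit.HodgeConjecture.HodgeConjecture.Cruxes.HLiu418.K2LiuFirstTermResidueForm (resNorm_finset_sum)
open Summit.HodgeConjecture.HodgeConjecture.Cruxes.HLiu418.K2LiuFirstTermResidueGenDefs

variable (L : Type) [Field L] [NumberField L] [IsCMField L]
variable {N M n : ℕ} (e : Fin N × Fin M ≃ Fin n)
  (dV : Fin N → L) (hdV : ∀ i, IsCMField.complexConj L (dV i) = dV i) (hdV0 : ∀ i, dV i ≠ 0)
  (dW : Fin M → L) (hdW : ∀ i, IsCMField.complexConj L (dW i) = dW i) (hdW0 : ∀ i, dW i ≠ 0)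

include hdV0 hdW0 in
/-- **`resGen` OF A FINITE LINEAR COMBINATION.**  `χ` unitary; `g_j` continuous Siegel section families (★ `IsSiegelDeltaSection`); `f = Σ_j c_j • g_j`; `hex`, `hexg j` socket #41's
continuation packages for `f` and the `g_j` (so that the canonical residue forms exist).  Then `resGen hex = fun h => Σ_j c_j · resGen (hexg j) h` — ★ U0.4 `resNorm_finset_sum` on the
chosen continuations (★ `exists_continuation_resGen`). [cite: KudlaRallis1994, §1 Thm. 1.1] [cite: Liu2021, Lem. B.12 pp. 103–104] [cite: MoeglinWaldspurger1995, IV.1.9–IV.1.11] -/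
theorem resGen_finset_sum (χ : HeckeCharacter L) (hχ : χ.IsUnitary) {m : ℕ} (c : Fin m → ℂ)
    (g : Fin m → ℂ → HA L e dV hdV dW hdW → ℂ)
    (hg : ∀ j s, IsSiegelDeltaSection L e dV hdV dW hdW χ s (g j s)) (hgc : ∀ j s, Continuous (g j s))
    {f : ℂ → HA L e dV hdV dW hdW → ℂ} (hf : f = ∑ j, c j • g j)
    (hex : ∃ (P : Finset ℂ) (Es : ℂ → HA L e dV hdV dW hdW → ℂ),
      (∀ h : HA L e dV hdV dW hdW, DifferentiableOn ℂ (fun s => Es s h) {s : ℂ | 0 < s.re}) ∧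
      (∀ s : ℂ, 0 < s.re → Continuous (Es s)) ∧
      (∀ s : ℂ, 0 < s.re → ∀ (γ : ratH L e dV hdV dW hdW) (h : HA L e dV hdV dW hdW),
        Es s ((γ : HA L e dV hdV dW hdW) * h) = Es s h) ∧
      (∀ (s : ℂ) (h : HA L e dV hdV dW hdW), (n : ℝ) / 2 < s.re →
        Es s h = (∏ p ∈ P, (s - p)) * eisensteinFamilyDelta L e dV hdV dW hdW f s h) ∧
      (∀ z : ℂ, 0 < z.re → ∃ C A r : ℝ, 0 < r ∧ ∀ s : ℂ, dist s z < r → ∀ h : HA L e dV hdV dW hdW,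
        ‖Es s h‖ ≤ C * adelicHeightGL (n + n) L (h : GL (Fin (n + n)) (AdeleRing (𝓞 L) L)) ^ A))
    (hexg : ∀ j : Fin m, ∃ (P : Finset ℂ) (Es : ℂ → HA L e dV hdV dW hdW → ℂ),
      (∀ h : HA L e dV hdV dW hdW, DifferentiableOn ℂ (fun s => Es s h) {s : ℂ | 0 < s.re}) ∧
      (∀ s : ℂ, 0 < s.re → Continuous (Es s)) ∧
      (∀ s : ℂ, 0 < s.re → ∀ (γ : ratH L e dV hdV dW hdW) (h : HA L e dV hdV dW hdW),
        Es s ((γ : HA L e dV hdV dW hdW) * h) = Es s h) ∧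
      (∀ (s : ℂ) (h : HA L e dV hdV dW hdW), (n : ℝ) / 2 < s.re →
        Es s h = (∏ p ∈ P, (s - p)) * eisensteinFamilyDelta L e dV hdV dW hdW (g j) s h) ∧
      (∀ z : ℂ, 0 < z.re → ∃ C A r : ℝ, 0 < r ∧ ∀ s : ℂ, dist s z < r → ∀ h : HA L e dV hdV dW hdW,
        ‖Es s h‖ ≤ C * adelicHeightGL (n + n) L (h : GL (Fin (n + n)) (AdeleRing (𝓞 L) L)) ^ A)) :
    resGen hex = fun h => ∑ j, c j * resGen (hexg j) h := by
  -- the chosen continuations of `f` and of the `g_j`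
  obtain ⟨P, Es, ⟨hd, -, -, hiv, -⟩, hres⟩ := exists_continuation_resGen hex
  have hresg : ∀ j, resGen (hexg j) = resNorm (hexg j).choose (hexg j).choose_spec.choose := fun j => resGen_def (hexg j)
  have key := resNorm_finset_sum L e dV hdV hdV0 dW hdW hdW0 χ hχ c g hg hgc f hf P Es hd hiv
    (fun j => (hexg j).choose) (fun j => (hexg j).choose_spec.choose)
    (fun j => (hexg j).choose_spec.choose_spec.1) (fun j => (hexg j).choose_spec.choose_spec.2.2.2.1)
  rw [hres, key]
  funext h
  exact Finset.sum_congr rfl fun j _ => by rw [hresg j]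

include hdV0 hdW0 in
/-- **`resGen = 0` FOR A FINITE LINEAR COMBINATION WHOSE PARTS HAVE `resGen = 0`** — the (α)-linearity step of U1-glob: prove the local-kernel vanishing one PURE term at a time
(B1 + B2a + B2b) and sum. [cite: KudlaRallis1994, §1 Thm. 1.1] [cite: Liu2021, Lem. B.12 pp. 103–104] -/
theorem resGen_eq_zero_of_finset_sum (χ : HeckeCharacter L) (hχ : χ.IsUnitary) {m : ℕ} (c : Fin m → ℂ)
    (g : Fin m → ℂ → HA L e dV hdV dW hdW → ℂ)
    (hg : ∀ j s, IsSiegelDeltaSection L e dV hdV dW hdW χ s (g j s)) (hgc : ∀ j s, Continuous (g j s))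
    {f : ℂ → HA L e dV hdV dW hdW → ℂ} (hf : f = ∑ j, c j • g j)
    (hex : ∃ (P : Finset ℂ) (Es : ℂ → HA L e dV hdV dW hdW → ℂ),
      (∀ h : HA L e dV hdV dW hdW, DifferentiableOn ℂ (fun s => Es s h) {s : ℂ | 0 < s.re}) ∧
      (∀ s : ℂ, 0 < s.re → Continuous (Es s)) ∧
      (∀ s : ℂ, 0 < s.re → ∀ (γ : ratH L e dV hdV dW hdW) (h : HA L e dV hdV dW hdW),
        Es s ((γ : HA L e dV hdV dW hdW) * h) = Es s h) ∧
      (∀ (s : ℂ) (h : HA L e dV hdV dW hdW), (n : ℝ) / 2 < s.re →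
        Es s h = (∏ p ∈ P, (s - p)) * eisensteinFamilyDelta L e dV hdV dW hdW f s h) ∧
      (∀ z : ℂ, 0 < z.re → ∃ C A r : ℝ, 0 < r ∧ ∀ s : ℂ, dist s z < r → ∀ h : HA L e dV hdV dW hdW,
        ‖Es s h‖ ≤ C * adelicHeightGL (n + n) L (h : GL (Fin (n + n)) (AdeleRing (𝓞 L) L)) ^ A))
    (hexg : ∀ j : Fin m, ∃ (P : Finset ℂ) (Es : ℂ → HA L e dV hdV dW hdW → ℂ),
      (∀ h : HA L e dV hdV dW hdW, DifferentiableOn ℂ (fun s => Es s h) {s : ℂ | 0 < s.re}) ∧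
      (∀ s : ℂ, 0 < s.re → Continuous (Es s)) ∧
      (∀ s : ℂ, 0 < s.re → ∀ (γ : ratH L e dV hdV dW hdW) (h : HA L e dV hdV dW hdW),
        Es s ((γ : HA L e dV hdV dW hdW) * h) = Es s h) ∧
      (∀ (s : ℂ) (h : HA L e dV hdV dW hdW), (n : ℝ) / 2 < s.re →
        Es s h = (∏ p ∈ P, (s - p)) * eisensteinFamilyDelta L e dV hdV dW hdW (g j) s h) ∧
      (∀ z : ℂ, 0 < z.re → ∃ C A r : ℝ, 0 < r ∧ ∀ s : ℂ, dist s z < r → ∀ h : HA L e dV hdV dW hdW,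
        ‖Es s h‖ ≤ C * adelicHeightGL (n + n) L (h : GL (Fin (n + n)) (AdeleRing (𝓞 L) L)) ^ A))
    (hzero : ∀ j, resGen (hexg j) = 0) :
    resGen hex = 0 := by
  rw [resGen_finset_sum L e dV hdV hdV0 dW hdW hdW0 χ hχ c g hg hgc hf hex hexg]
  funext h
  exact Finset.sum_eq_zero fun j _ => by rw [hzero j, Pi.zero_apply, mul_zero]

end Summit.HodgeConjecture.HodgeConjecture.Cruxes.HLiu418.K2LiuResidueGenFinsetSum

end
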